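import Summits.BirchSwinnertonDyer.BirchSwinnertonDyer.Theorems.UniversalToricDescentToricKernelAtThreeFlat
import HarnessLib

/-!
# BSD_p at an ADDITIVE prime in analytic rank ONE, Schneider-free and height-free: for EVERY curve `E/ℚ` additive at an
# odd prime `p` with `r_an(E) = 1`, `BSD_p(E)` follows from ONE analytic statement at `E` — the ♭-(∅,0)-main-conjecture
# EQUALITY `Ch_Λ(X_ac(E/K_∞) strict at 𝔭′)·𝓞_{ℂ_p}⟦T⟧ = (Q)` —, exact anticyclotomic control at `p`, `BSD_p` of the
# rank-zero twist `E^{(d_K)}`, and two refereed inputs (Hsieh 2014 Thm A any level; Liu–Zhang–Zhang 2018 Thm 1.5.1/1.5.3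
# additive) which now carry the VALUE — the anticyclotomic form of this seat's purpose «descent ⟹ BSD_p at an additive
# potentially supersingular prime, r = 1» (cell bsd-potss, K9 residuals 19200 `WildRankOne` / 19984 `TameRankOne`)

Prover seat `bsd-potss-kmc` (g19), 2026-08-27. HONEST FRAMING: ONE THEOREM (0 definitions, 0 named facts, 0 `sorry`);
CONDITIONAL on every displayed hypothesis; closes nothing; BSD_p for no curve. The generic-`p` sibling of
`bsdp_three_of_flatIMCEq_of_control_of_rankZero` (p547540, the wild `3` / W-ALL leaf form): no reduction-TYPE hypothesis
at `p` beyond `Addv W p` (potentially multiplicative, ordinary or supersingular, tame or wild alike), no image hypothesis, no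
twin; the Heegner field is chosen by Friedberg–Hoffstein with `2` and `3` split (`d_K` odd, `d_K < −4`, so `p ∤ #𝓞_K^×`).

**`bsdp_of_flatIMCEq_of_control_of_twist`** `(p) (hp2 : p ≠ 2) : hA → hL → ToricPublishedInputs → hEq♭ → hCtl → hTw → ∀ W,
Addv W p → W.analyticRank = 1 → BSDp W p`, where, over every Heegner datum `(N, K, Dt, H, ι, P)` of `W` at a classical
Heegner field `K` with `p` split (all quantified):
* `hEq♭` — for every anticyclotomic `(κ, γ)`, degree-one `𝔭 ∋ p`, `𝔭′ ∋ p` with `𝔭′ ≠ 𝔭`, `ι′` inducing `𝔭` and every ♭-frame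
  `Q` of `Dt.f`: `(XAc.charIdeal (W.baseChange K) p κ 𝔭′ ∅ γ).map (PowerSeries.map (R1.toCpInt p)) = Ideal.span {Q}` —
  RESEARCH-GRADE (the (∅,0) main conjecture for `f_E` at an additive split prime; UTD #2/#3, SOED J, K1 H3 are its faces);
* `hCtl` — `SchneiderFree.AdditiveControlOnTreeAt p κ 𝔭 γ (embAt K p 𝔭) P` at every degree-one `𝔭 ∋ p` (Kolyvagin as
  antecedent) — K1's control corner (closed at `(ClassX3, SubSemistableTwist)` and at wild `3` modulo published facts);
* `hTw` — `BSD_p` of a globally minimal model of the twist `E^{(d_K)}` (analytic rank `0`) — the rank-zero leaf at `p`.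
Proof: the JSW §7.4 assembly of `toricKernelAtThree_flat` at a general `p`, terminal step kmc g17's
`SchneiderFree.Exact.bsdp_of_exactIndexManin_of_partner_bsdp` (p528239, generic odd `p ∣ N`).

References: [JetchevSkinnerWan2017] §7.4.1; [Castella2018] Thm 2.3, §5; [Hsieh2014] Thm A; [LiuZhangZhang2018] Thm 1.5.1/1.5.3;
[GrossZagier1986] I.(6.3); [FriedbergHoffstein1995] Thm B.
-/

noncomputable section

open scoped Classical

set_option linter.dupNamespace false
set_option autoImplicit false

namespace Summit.BirchSwinnertonDyer.BirchSwinnertonDyer.Theorems.UniversalToricDescentWaldspurgerFlat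

open WeierstrassCurve NumberField IsDedekindDomain Field PowerSeries
  Literature.NumberTheory.EllipticCurves
  Literature.NumberTheory.EllipticCurves.ModularForms
  Literature.NumberTheory.EllipticCurves.Rank1Residual
  Literature.NumberTheory.EllipticCurves.KrizLi2019
  Literature.NumberTheory.GaloisRepresentations
  Summit.BirchSwinnertonDyer.Rank1Residual
  Summit.BirchSwinnertonDyer.Rank1Residual.Additive
  Summit.BirchSwinnertonDyer.Rank1Residual.X11b
  Summit.BirchSwinnertonDyer.Rank1Residual.X11b.AcSelmer
  Summit.BirchSwinnertonDyer.Rank1Residual.X11b.Halves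
  Summit.BirchSwinnertonDyer.Rank1Residual.X11b.CongruenceLimit
  Summit.BirchSwinnertonDyer.BirchSwinnertonDyer.Theses.UniversalToricDescent

/-- **`BSD_p` in analytic rank one at ANY odd additive prime from the ♭-IMC equality at `E`, exact control, the rank-zero twist
and two refereed inputs.** See the module docstring for the hypotheses. CONDITIONAL; nothing booked.
[cite: JetchevSkinnerWan2017, §7.4.1 (arXiv:1512.06894 p. 30)] [cite: Hsieh2014, Thm. A p. 712 (Doc. Math. 19)]
[cite: LiuZhangZhang2018, Thm 1.5.1 and Thm 1.5.3 (Duke Math. J. 167 pp. 748–749)] [cite: FriedbergHoffstein1995, Thm. B] -/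
theorem bsdp_of_flatIMCEq_of_control_of_twist (p : ℕ) [Fact p.Prime] (hp2 : p ≠ 2)
    (hA : Hsieh2014.thmA_exists_isHsiehLFunction_unrPeriod_anyLevel)
    (hL : LiuZhangZhang2018.thm151_thm153_modularCurve_heegnerVector_additive)
    (hF : ToricPublishedInputs)
    (hEq : ∀ (W : WeierstrassCurve ℚ) [W.IsElliptic] [W.IsGloballyMinimal] (N : ℕ) [NeZero N] (K : Type) [Field K]
      [NumberField K] (Dt : ModularParametrizationData W N),
      Addv W p → W.analyticRank = 1 → W.conductorNorm ℤ = N → IsImaginaryQuadratic K → SatisfiesHeegnerHypothesis N K →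
      ∀ (κ : ZpExtension K p), κ.IsAnticyclotomic → ∀ (γ : Field.absoluteGaloisGroup K) [Fact (κ.IsTopGenerator γ)]
        (𝔭 : HeightOneSpectrum (𝓞 K)), ((p : ℕ) : 𝓞 K) ∈ 𝔭.asIdeal → 𝔭.asIdeal.ramificationIdx (𝓞 ℚ) = 1 →
        𝔭.asIdeal.inertiaDeg (𝓞 ℚ) = 1 → ∀ (𝔭' : HeightOneSpectrum (𝓞 K)), ((p : ℕ) : 𝓞 K) ∈ 𝔭'.asIdeal → 𝔭' ≠ 𝔭 →
        ∀ (ι' : PadicAlgCl p ≃+* ℂ), SchneiderFree.BranchInducesPrime p ι' 𝔭 →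
        ∀ (ΩK : ℂ) (Ωp : ℂ_[p]) (Q : PowerSeries (PadicComplexInt p)), ΩK ≠ 0 → Ωp ≠ 0 →
          R1.IsBDPLFunctionInt p ι' 𝔭 κ γ Dt.f ΩK Ωp Q →
          (XAc.charIdeal (W.baseChange K) p κ 𝔭' ∅ γ).map (PowerSeries.map (R1.toCpInt p)) = Ideal.span {Q})
    (hCtl : ∀ (W : WeierstrassCurve ℚ) [W.IsElliptic] [W.IsGloballyMinimal] (N : ℕ) [NeZero N] (K : Type) [Field K]
      [NumberField K] (Dt : ModularParametrizationData W N) (H : HeegnerDatum N (NumberField.discr K)) (ι : K →+* ℂ)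
      (P : (W.baseChange K).toAffine.Point),
      Addv W p → W.analyticRank = 1 → W.conductorNorm ℤ = N → IsImaginaryQuadratic K → SatisfiesHeegnerHypothesis N K →
      (W.quadraticTwist (NumberField.discr K : ℚ)).entireLFunction 1 ≠ 0 →
      WeierstrassCurve.Affine.Point.map ι.toRatAlgHom P = heegnerPointComplex Dt H → ¬ IsOfFinAddOrder P →
      Literature.NumberTheory.EllipticCurves.kolyvagin N W K →
      ∀ (κ : ZpExtension K p), κ.IsAnticyclotomic → ∀ (γ : Field.absoluteGaloisGroup K) [Fact (κ.IsTopGenerator γ)]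
        (𝔭 : HeightOneSpectrum (𝓞 K)) (h𝔭 : ((p : ℕ) : 𝓞 K) ∈ 𝔭.asIdeal) (he : 𝔭.asIdeal.ramificationIdx (𝓞 ℚ) = 1)
        (hf : 𝔭.asIdeal.inertiaDeg (𝓞 ℚ) = 1),
        SchneiderFree.AdditiveControlOnTreeAt p κ 𝔭 γ (embAt K p 𝔭 h𝔭 he hf) P)
    (hTw : ∀ (W : WeierstrassCurve ℚ) [W.IsElliptic] [W.IsGloballyMinimal] (N : ℕ) [NeZero N] (K : Type) [Field K]
      [NumberField K] (Wd : WeierstrassCurve ℚ) [Wd.IsElliptic] [Wd.IsGloballyMinimal],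
      Addv W p → W.analyticRank = 1 → W.conductorNorm ℤ = N → IsImaginaryQuadratic K → SatisfiesHeegnerHypothesis N K →
      (∃ C : VariableChange ℚ, C • W.quadraticTwist (NumberField.discr K : ℚ) = Wd) →
      (W.quadraticTwist (NumberField.discr K : ℚ)).entireLFunction 1 ≠ 0 → BSDp Wd p) :
    ∀ (W : WeierstrassCurve ℚ) [W.IsElliptic] [W.IsGloballyMinimal], Addv W p → W.analyticRank = 1 → BSDp W p := by
  intro W _ _ haddv hr
  have hp : p.Prime := Fact.out
  obtain ⟨hGZ, hKo, hGZK, hmod, hmodP, -, hGZ73, hFH, hpar, hHP⟩ := hF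
  haveI hN0 : NeZero (W.conductorNorm ℤ) := ⟨W.conductorNorm_pos_holds.ne'⟩
  -- (a) DATA. parity: `r_an = 1` is odd, so `w(E) = -1`
  have hw : W.rootNumber = -1 := by
    rcases W.rootNumber_eq_one_or with h | h
    · exfalso
      have heven : Even W.analyticRank := (hpar W).mpr h
      rw [hr] at heven
      exact Nat.not_even_one heven
    · exact h
  -- Friedberg–Hoffstein with auxiliary modulus `6`: Heegner for `N(E)`, `2` and `3` split (`d_K` odd, `d_K < −4`)
  obtain ⟨K, _, _, hK, -, hHN, hH6, hLt⟩ := hFH W hw 6 (by norm_num) 0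
  have hodd : Odd (NumberField.discr K) := by
    have h8 := Literature.SatisfiesHeegnerHypothesis.discr_emod_eight hK.1 hH6 (by norm_num : (2 : ℕ) ∣ 6)
    rw [Int.odd_iff]; omega
  have hd4 : NumberField.discr K < -4 :=
    discr_lt_neg_four_of_three_split hK (hH6 3 Nat.prime_three (by norm_num : (3 : ℕ) ∣ 6))
  have hwK : ¬ p ∣ Units.torsionOrder K := by
    rw [Literature.NumberTheory.QuadraticFields.Quadratic.torsionOrder_eq_two_of_discr_lt_neg_four hK.1 hd4]
    intro h
    exact hp2 ((Nat.prime_dvd_prime_iff_eq hp Nat.prime_two).mp h)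
  -- `p ∣ N(E)` (additive) splits in `K`
  have hpN : p ∣ W.conductorNorm ℤ :=
    (W.dvd_conductorNorm_iff_not_hasGoodReductionAtPrime p).mpr (not_good_of_addv W p haddv)
  have hsplit : SplitsIn K p := hHN p hp hpN
  have hp2N : p ^ 2 ∣ W.conductorNorm ℤ := by
    by_contra h
    rcases hasGoodReductionAtPrime_or_hasMultiplicativeReductionAtPrime_of_not_sq_dvd_conductorNorm (V := W) h
      with hg | hm
    · exact haddv.1 hg
    · exact haddv.2 hm
  -- the Heegner point over `K` and its data; non-torsion by Gross–Zagier
  obtain ⟨P, Dt, H, ι, hP⟩ := hHP W K hK hHN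
  have hL0 : W.entireLFunction 1 = 0 := entireLFunction_one_eq_zero_of_analyticRank_eq_one hr
  obtain ⟨-, hderiv⟩ := leadingLCoeff_eq_deriv_of_analyticRank_eq_one hr
  have hLK : LDerivEK W K ≠ 0 := by
    rw [lDerivEK_eq_deriv_mul W K hmod hL0]; exact mul_ne_zero hderiv hLt
  have hnt : ¬ IsOfFinAddOrder P :=
    (lDerivEK_ne_zero_iff_not_isOfFinAddOrder W (W.conductorNorm ℤ) K (hGZ _ W K) hK hHN
      ⟨Dt, H, ι, hP⟩).mp hLK
  -- Kolyvagin: `rank E(K) = 1`, `Ш(E/K)` finite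
  obtain ⟨hrk, hfin⟩ := hKo (W.conductorNorm ℤ) W K hK hHN ⟨Dt, H, ι, hP⟩ hnt
  -- a frame `(κ, γ, 𝔭)` and the other prime `𝔭′ ≠ 𝔭` above `3`
  obtain ⟨κ, γ, -, hκ, hγ, -⟩ := X11b.exists_anticyclotomic_generator_prime (p := p) hK
  haveI : Fact (κ.IsTopGenerator γ) := ⟨hγ⟩
  obtain ⟨𝔭, h𝔭, he, hf⟩ := X11b.exists_degreeOnePrime_of_splitsIn K p hK.1 hsplit
  obtain ⟨𝔭', hne, h𝔭', he', hf'⟩ := X11b.Three.exists_ne_degreeOne_prime hK.1 h𝔭 he hf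
  -- (b) PLUMBING. an embedding datum inducing `𝔭`, the ♭-frame of `Dt.f` there and its unit-norm value (Hsieh + LZZ)
  obtain ⟨ι₀⟩ := PadicAlgCl.nonempty_ringEquiv_complex p
  obtain ⟨ι', -, hind⟩ := exists_datum_forall_mem_iff p ι₀ hK h𝔭
  obtain ⟨ΩK, Ωp', Q, hΩK, hBDP, u, hu, hval⟩ :=
    exists_frameInt_value_manin hA hL W K 𝔭 κ γ Dt H ι P hp2 rfl hp2N hK hd4 h𝔭 he hf hHN hκ hP hnt ι' hind
  have hΩp : ((Ωp' : unrIntegers p) : ℂ_[p]) ≠ 0 := fun h0 ↦ by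
    have h1 := norm_coe_units_unrIntegers p Ωp'
    rw [h0, norm_zero] at h1
    exact zero_ne_one h1
  set Ωp : ℂ_[p] := ((Ωp' : unrIntegers p) : ℂ_[p]) with hΩpdef
  -- the ♭-IMC EQUALITY for `E` at the frame `Q` (the research input)
  have heq : (XAc.charIdeal (W.baseChange K) p κ 𝔭' ∅ γ).map (PowerSeries.map (R1.toCpInt p)) =
      Ideal.span {Q} :=
    hEq W (W.conductorNorm ℤ) K Dt haddv hr rfl hK hHN κ hκ γ 𝔭 h𝔭 he hf 𝔭' h𝔭' hne ι' hind ΩK Ωp Q hΩK hΩp hBDP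
  -- control EQUALITY at `𝔭′` (CTL₀ included)
  have hctl : SchneiderFree.AdditiveControlOnTreeAt p κ 𝔭' γ (embAt K p 𝔭' h𝔭' he' hf') P :=
    hCtl W (W.conductorNorm ℤ) K Dt H ι P haddv hr rfl hK hHN hLt hP hnt (hKo _ W K) κ hκ γ 𝔭' h𝔭' he' hf'
  obtain ⟨n, hn, hneq⟩ := hctl
  -- the value read through the logarithm at `𝔭′` (rank one: `(log_{𝔭′} P)² = (log_𝔭 P)²`)
  have hc0 : Dt.c ≠ 0 := Dt.maninConstant_ne_zero_holds
  have hc0' : (Dt.c : ℚ_[p]) ≠ 0 := by exact_mod_cast hc0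
  have hlog : logOmega W p (embAt K p 𝔭' h𝔭' he' hf') P ≠ 0 := X11b.R1.logOmega_ne_zero W p _ hnt
  have hsq : (algebraMap ℚ_[p] ℂ_[p] (logOmega W p (embAt K p 𝔭 h𝔭 he hf) P / (Dt.c : ℚ_[p]))) ^ 2 =
      (algebraMap ℚ_[p] ℂ_[p] (logOmega W p (embAt K p 𝔭' h𝔭' he' hf') P / (Dt.c : ℚ_[p]))) ^ 2 := by
    rw [← map_pow, ← map_pow, div_pow, div_pow,
      SchneiderFreeAdditiveX3.sq_logOmega_embAt_eq_of_rank_one W p hK.1 hrk h𝔭 he hf h𝔭' he' hf' P]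
  have hval' : IntSeries.HasValueAt Q 0
      (u * (algebraMap ℚ_[p] ℂ_[p] (logOmega W p (embAt K p 𝔭' h𝔭' he' hf') P / (Dt.c : ℚ_[p]))) ^ 2) := by
    rw [← hsq]; exact hval
  have hy0 : logOmega W p (embAt K p 𝔭' h𝔭' he' hf') P / (Dt.c : ℚ_[p]) ≠ 0 := div_ne_zero hlog hc0'
  -- both sockets at slack `v₃(c)` at the frame `(κ, 𝔭′, γ, embAt 𝔭′)`, by §1
  have hlow : SchneiderFree.AdditiveIMCLowerBDPOnTreeLeAt p κ 𝔭' γ (embAt K p 𝔭' h𝔭' he' hf')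
      (padicValNat p Dt.c.natAbs) P := by
    obtain ⟨htors, f, hfI, hf0, hfn⟩ := hn
    have hmem : PowerSeries.map (R1.toCpInt p) f ∈ Ideal.span {Q} := by
      have h3 := heq.le
      rw [hfI, map_span_singleton_powerSeries] at h3
      exact (Ideal.span_singleton_le_iff_mem _).mp h3
    obtain ⟨-, hle⟩ := int_two_mul_valuation_le_of_map_mem_span hf0 hmem hu hval'
    rw [div_eq_mul_inv, Padic.valuation_mul hlog (inv_ne_zero hc0'), Padic.valuation_inv,
      Padic.valuation_intCast, valuation_logOmega hlog, hfn] at hle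
    refine ⟨n, ⟨htors, f, hfI, hf0, hfn⟩, ?_⟩
    simp only [padicValInt] at hle
    linarith
  have hup : SchneiderFree.Upper.AdditiveIMCUpperBDPOnTreeLeAt p κ 𝔭' γ (embAt K p 𝔭' h𝔭' he' hf')
      (padicValNat p Dt.c.natAbs) P := by
    obtain ⟨htors, f, hfI, hf0, hfn⟩ := hn
    have hmem : Q ∈ Ideal.span {PowerSeries.map (R1.toCpInt p) f} := by
      have h3 := heq.ge
      rw [hfI, map_span_singleton_powerSeries] at h3
      exact (Ideal.span_singleton_le_iff_mem _).mp h3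
    have hle := int_valuation_le_two_mul_of_mem_span_map hf0 hmem hu hy0 hval'
    rw [div_eq_mul_inv, Padic.valuation_mul hlog (inv_ne_zero hc0'), Padic.valuation_inv,
      Padic.valuation_intCast, valuation_logOmega hlog, hfn] at hle
    refine ⟨n, ⟨htors, f, hfI, hf0, hfn⟩, ?_⟩
    simp only [padicValInt] at hle
    linarith
  -- the EXACT index at slack `v₃(c)` (both halves), by K1's links with the control equality
  have hlo : SchneiderFree.IndexLowerBoundLeAt W p K P (padicValNat p Dt.c.natAbs) :=
    SchneiderFreeAdditiveX3.indexLowerBoundLeAt_of_imcLowerLe_of_control rfl hK hHN hfin hlow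
      ⟨n, hn, hneq⟩
  have hupI : SchneiderFree.Upper.IndexUpperBoundLeAt W p K P (padicValNat p Dt.c.natAbs) :=
    SchneiderFree.Upper.indexUpperBoundLeAt_of_imcUpperLe_of_control rfl hK hHN hfin hup ⟨n, hn, hneq⟩
  -- (c) TERMINAL STEP: a globally minimal model of the twist, its `BSD_p` (hypothesis), then p528239
  have hD0 : (NumberField.discr K : ℚ) ≠ 0 := by exact_mod_cast NumberField.discr_ne_zero K
  haveI : (W.quadraticTwist (NumberField.discr K : ℚ)).IsElliptic := W.isElliptic_quadraticTwist hD0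
  obtain ⟨Cd, hCd⟩ := hasGlobalMinimalModel_rat_holds (W.quadraticTwist (NumberField.discr K : ℚ))
  haveI : (Cd • W.quadraticTwist (NumberField.discr K : ℚ)).IsGloballyMinimal := hCd
  have hWd : BSDp (Cd • W.quadraticTwist (NumberField.discr K : ℚ)) p :=
    hTw W (W.conductorNorm ℤ) K (Cd • W.quadraticTwist (NumberField.discr K : ℚ)) haddv hr rfl hK hHN ⟨Cd, rfl⟩ hLt
  exact SchneiderFree.Exact.bsdp_of_exactIndexManin_of_partner_bsdp hGZ hKo hGZK hmod hGZ73 W p (W.conductorNorm ℤ) K Dt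
    H ι P (Cd • W.quadraticTwist (NumberField.discr K : ℚ)) hr rfl hpN hK hodd hwK hHN hLt hP ⟨Cd, rfl⟩ hp2 hlo hupI hWd

end Summit.BirchSwinnertonDyer.BirchSwinnertonDyer.Theorems.UniversalToricDescentWaldspurgerFlat

end
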